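import Mathlib
import HarnessLib
import Summits.KontsevichZagierPeriods.Zeta5Search.SorokinLastVariable
import Summits.KontsevichZagierPeriods.Zeta5Search.SorokinConvergenceVWP

/-!
# ζ(5) search — integrability of Zudilin's `J_k`-integrand at COMPLEX parameters in the parametrisation of (4) (cell `pub-zeta5`, ct-1 g27)

HONEST FRAMING: systematic search; no irrationality claim unless kernel-certified.  A convergence statement; nothing here is an
irrationality result, a worthiness exponent or a denominator statement; no named fact is discharged; no definition is introduced.

For B6 of `HOME/ct-1/g27/VWP-BLUEPRINT-g27.md`: Zudilin's induction runs `SorokinLemma3.lemma3` with the parameters of (4),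
`a₀ = h₁`, `a_j = h_{j+2}`, `b_j = 1 + h₀ − h_{j+3}` (0-indexed `j`), at COMPLEX `h`.  Its integrability hypotheses are discharged here
from the typed hypotheses of `vwp_eq_integral_of_pos` imposed on the REAL PARTS:

* `integrableOn_integrand_vwp` — for `k ≥ 1` and `h : ℕ → ℂ` with (5) `(2/(k+1)) Σ_{j=1}^{k+2} Re h_j < 1 + Re h₀`,
  (6) `0 < Re h_j < 1 + Re h₀ − Re h_{j+1}` (`2 ≤ j ≤ k+1`), `0 ≤ Re h₁`, `Re h₁ + Re h₂ < 1 + Re h₀`, the complex integrand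
  `∏ x_j^{h_{j+2}−1}(1−x_j)^{(1+h₀−h_{j+3})−h_{j+2}−1} Q_k^{−h₁}` is integrable on `[0,1]^k`
  (`SorokinConvergenceVWP.integrableOn_sorokinIntegrand_vwp` at `Re ∘ h` + `SorokinLastVariable.norm_integrand`).

Theorems only; imports `Zeta5Search/SorokinLastVariable`, `Zeta5Search/SorokinConvergenceVWP`.
-/

noncomputable section

namespace Summit.KontsevichZagierPeriods.Zeta5Search.SorokinIntegrableVWP

open MeasureTheory Set Filter
open Literature.NumberTheory.Irrationality.Zudilin2002 (nestedQ sorokinIntegrand)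
open Summit.KontsevichZagierPeriods.Zeta5Search.SorokinIntegrandBounds
open Summit.KontsevichZagierPeriods.Zeta5Search.SorokinLastVariable
open Summit.KontsevichZagierPeriods.Zeta5Search.SorokinConvergenceVWP

/-- **Integrability of the `J_k`-integrand of (4) at complex parameters** under the typed hypotheses on the real parts. -/
theorem integrableOn_integrand_vwp {k : ℕ} (hk : 1 ≤ k) (h : ℕ → ℂ)
    (h5 : (2 / ((k : ℝ) + 1)) * (∑ j ∈ Finset.Icc 1 (k + 2), (h j).re) < 1 + (h 0).re)
    (h6 : ∀ j ∈ Finset.Icc 2 (k + 1), 0 < (h j).re ∧ (h j).re < 1 + (h 0).re - (h (j + 1)).re)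
    (h1 : 0 ≤ (h 1).re) (h12 : (h 1).re + (h 2).re < 1 + (h 0).re) :
    IntegrableOn (fun x : Fin k → ℝ =>
      (∏ j : Fin k, ((x j : ℝ) : ℂ) ^ (h ((j : ℕ) + 2) - 1) *
          (1 - ((x j : ℝ) : ℂ)) ^ ((1 + h 0 - h ((j : ℕ) + 3)) - h ((j : ℕ) + 2) - 1)) *
        ((nestedQ (List.ofFn x) : ℝ) : ℂ) ^ (-h 1)) (Set.pi univ fun _ : Fin k => Icc (0 : ℝ) 1) volume := by
  have hreal := integrableOn_sorokinIntegrand_vwp hk (fun n => (h n).re) h5 h6 h1 h12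
  have hae : (Set.pi univ fun _ : Fin k => Icc (0 : ℝ) 1) =ᵐ[volume] (Set.pi univ fun _ : Fin k => Ioo (0 : ℝ) 1) := by
    rw [volume_pi]; exact Measure.pi_Ioo_ae_eq_pi_Icc.symm
  rw [IntegrableOn, Measure.restrict_congr_set hae] at hreal ⊢
  refine hreal.mono' (measurable_integrand k (h 1) (fun i => h (i + 2)) (fun i => 1 + h 0 - h (i + 3))).aestronglyMeasurable ?_
  filter_upwards [ae_restrict_mem (MeasurableSet.univ_pi fun _ => measurableSet_Ioo)] with x hx
  have hx' : ∀ j, x j ∈ Ioo (0 : ℝ) 1 := fun j => hx j (mem_univ _)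
  have hn := norm_integrand k (h 1) (fun i => h (i + 2)) (fun i => 1 + h 0 - h (i + 3)) hx'
  have e : (fun n => (1 + h 0 - h (n + 3)).re) = fun n => 1 + (h 0).re - (h (n + 3)).re := by
    funext n; simp
  rw [e] at hn
  exact hn.le

end Summit.KontsevichZagierPeriods.Zeta5Search.SorokinIntegrableVWP

end
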